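import Mathlib
import Literature.Probability.Percolation.DiagonalStripNCSuccessor
import Literature.Probability.LatticeModels.TemperleyLiebSpinChain
import HarnessLib

/-!
# The embedding of the connectivity basis into the spin chain: equivariance

Topic `Literature/Probability/Percolation`. The connectivity state `s` (a non-crossing partition of
the sites `0, …, m`, `NCState (m+1)`) is the non-crossing matching of the positions `0, …, 2m+1` with
the arcs `(2p+1, 2·nxt p)`; the spin chain has the `2m+1` sites `1, …, 2m+1` and the position `0` is a
boundary point with fixed spin `↓`. **The embedding** sends `s` to the vector
`M(s) = Σ_σ Mc(σ, s) σ`, `Mc(σ, s) = ∏_{arcs (i<j)} c(σ̂_i, σ̂_j)` with `c(↑,↓) = 1`, `c(↓,↑) = -q`,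
`c(↑,↑) = c(↓,↓) = 0` (**`embMc`**) — the `q`-singlet basis. It intertwines the Temperley–Lieb
generators: **`embMc_joinS`** (`U_{2b+1} M = M e_{2b+1}`, the join of `b, b+1`) and **`embMc_isolS`**
(`U_{2b+2} M = M e_{2b+2}`, the isolation of `b+1`), written entrywise as
`Mc(σ, e s) = [σ_a ≠ σ_{a+1}] (d(σ_a) Mc(σ, s) + Mc(σ^{(a,a+1)}, s))` with the spin-chain generator
`U` of `TemperleyLiebSpinChain` (`d(↓) = -q`, `d(↑) = -q⁻¹`).

## References

* Y. Ikhlef, A. K. Ponsaing, *Finite-size left-passage probability in percolation*, J. Stat. Phys.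
  149 (2012) 10–36, arXiv:1202.5476, §3.1. [IkhlefPonsaing2012]
* C. Hagendorf, J. Liénardy, *The open XXZ chain at Δ = -1/2 and the boundary quantum
  Knizhnik–Zamolodchikov equations*, J. Stat. Mech. (2021) 013104, arXiv:2008.03220, §2. [HagendorfLienardy2021]
-/

noncomputable section

namespace Literature.Probability.Percolation

open Finset Literature.Probability.LatticeModels Literature.Probability.LatticeModels.TemperleyLieb

variable {m : ℕ}

/-! ### Positions, weights and the coefficients of the embedding -/

section Defs

/-- The spin at the position `k ∈ [0, 2m+1]`: position `0` is the boundary point (spin `↓`), the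
position `k ≥ 1` is the site `k - 1`. [folklore] -/
def sh (σ : SpinConfig (2 * m + 1)) (k : ℕ) : Bool := if h : 1 ≤ k ∧ k ≤ 2 * m + 1 then σ ⟨k - 1, by omega⟩ else true

/-- The arc weight with `x` at the left endpoint: `c(↑,↓) = 1`, `c(↓,↑) = -q`, zero for equal spins. [folklore] -/
def cW (q : ℂ) (x y : Bool) : ℂ := if x = y then 0 else if x then -q else 1

/-- The weight of the arc from the out-position of a site (spin `x`) to the in-position of its successor
(spin `y`), forward or backward. [folklore] -/
def Wt (q : ℂ) (x y : Bool) (fwd : Prop) [Decidable fwd] : ℂ := if fwd then cW q x y else cW q y x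

/-- The weight of the arc of the site `p` to a prescribed successor `j`. [folklore] -/
def arcW (q : ℂ) (σ : SpinConfig (2 * m + 1)) (p j : Fin (m + 1)) : ℂ := Wt q (sh σ (2 * p.val + 1)) (sh σ (2 * j.val)) (p < j)

/-- **The coefficients of the embedding**: `Mc(σ, s) = ∏_p (weight of the arc of p)`. [cite: IkhlefPonsaing2012, §3.1] -/
def embMc (q : ℂ) (σ : SpinConfig (2 * m + 1)) (s : NCState (m + 1)) : ℂ := ∏ p : Fin (m + 1), arcW q σ p (nxt s p)

/-- The left site `2b` of the join level `2b+1`. [folklore] -/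
def jL (b : Fin m) : Fin (2 * m + 1) := ⟨2 * b.val, by omega⟩
/-- The right site `2b+1` of the join level `2b+1`. [folklore] -/
def jR (b : Fin m) : Fin (2 * m + 1) := ⟨2 * b.val + 1, by omega⟩
/-- The left site `2b+1` of the isolation level `2b+2`. [folklore] -/
def iL (b : Fin m) : Fin (2 * m + 1) := ⟨2 * b.val + 1, by omega⟩
/-- The right site `2b+2` of the isolation level `2b+2`. [folklore] -/
def iR (b : Fin m) : Fin (2 * m + 1) := ⟨2 * b.val + 2, by omega⟩

/-- The two join sites differ. [folklore] -/
theorem jL_ne_jR (b : Fin m) : jL b ≠ jR b := fun h => by have := congrArg Fin.val h; simp [jL, jR] at this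
/-- The two isolation sites differ. [folklore] -/
theorem iL_ne_iR (b : Fin m) : iL b ≠ iR b := fun h => by have := congrArg Fin.val h; simp [iL, iR] at this

end Defs

/-! ### The spins at the positions under a move -/

section Sh

/-- The spin at a site position. [folklore] -/
theorem sh_site (σ : SpinConfig (2 * m + 1)) (i : Fin (2 * m + 1)) : sh σ (i.val + 1) = σ i := by
  unfold sh; rw [dif_pos ⟨by omega, by omega⟩]
  congr 1

/-- **The spins after a move**: exchanged at the two positions, unchanged elsewhere. [folklore] -/
theorem sh_spinFlip {a c : Fin (2 * m + 1)} (hac : a ≠ c) (σ : SpinConfig (2 * m + 1)) (k : ℕ) :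
    sh (spinFlip a c σ) k = if k = a.val + 1 then sh σ (c.val + 1) else if k = c.val + 1 then sh σ (a.val + 1) else sh σ k := by
  by_cases h1 : k = a.val + 1
  · rw [if_pos h1, h1, sh_site, sh_site, spinFlip_apply_left hac]
  · rw [if_neg h1]
    by_cases h2 : k = c.val + 1
    · rw [if_pos h2, h2, sh_site, sh_site, spinFlip_apply_right]
    · rw [if_neg h2]
      unfold sh
      by_cases h : 1 ≤ k ∧ k ≤ 2 * m + 1
      · rw [dif_pos h, dif_pos h, spinFlip_apply_of_ne]
        · exact fun h' => h1 (by have := congrArg Fin.val h'; simp at this; omega)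
        · exact fun h' => h2 (by have := congrArg Fin.val h'; simp at this; omega)
      · rw [dif_neg h, dif_neg h]

/-- The arc weight of a site whose two positions avoid the moved ones is unchanged. [folklore] -/
theorem arcW_spinFlip_of_ne (q : ℂ) {a c : Fin (2 * m + 1)} (hac : a ≠ c) (σ : SpinConfig (2 * m + 1)) {p j : Fin (m + 1)}
    (h1 : 2 * p.val + 1 ≠ a.val + 1) (h2 : 2 * p.val + 1 ≠ c.val + 1) (h3 : 2 * j.val ≠ a.val + 1) (h4 : 2 * j.val ≠ c.val + 1) :
    arcW q (spinFlip a c σ) p j = arcW q σ p j := by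
  unfold arcW
  rw [sh_spinFlip hac, sh_spinFlip hac, if_neg h1, if_neg h2, if_neg h3, if_neg h4]

end Sh

/-! ### Splitting the product at two sites -/

section Split

variable {M : Type*} [CommMonoid M]

/-- `∏_p H p = H c · H t · ∏_{p ≠ c, t} H p`. [folklore] -/
theorem prod_split_two {c t : Fin (m + 1)} (hct : c ≠ t) (H : Fin (m + 1) → M) :
    ∏ p, H p = H c * H t * ∏ p ∈ (univ.erase c).erase t, H p := by
  rw [← mul_prod_erase univ H (mem_univ c), ← mul_prod_erase (univ.erase c) H (mem_erase.2 ⟨Ne.symm hct, mem_univ t⟩), mul_assoc]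

/-- The product along `nxt ∘ (c t)` split at `c` and `t`. [folklore] -/
theorem prod_nxt_swap {c t : Fin (m + 1)} (hct : c ≠ t) (f : Fin (m + 1) → Fin (m + 1)) (H : Fin (m + 1) → Fin (m + 1) → M) :
    ∏ p, H p (f (Equiv.swap c t p)) = H c (f t) * H t (f c) * ∏ p ∈ (univ.erase c).erase t, H p (f p) := by
  rw [prod_split_two hct, Equiv.swap_apply_left, Equiv.swap_apply_right]
  congr 1
  refine prod_congr rfl fun p hp => ?_
  rw [Equiv.swap_apply_of_ne_of_ne (ne_of_mem_erase (mem_of_mem_erase hp)) (ne_of_mem_erase hp)]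

end Split

/-! ### The finite identities -/

section Identities

variable {q : ℂ}

/-- A root of `q² + q + 1` is not zero. [folklore] -/
theorem ne_zero_of_quad' (hq : q ^ 2 + q + 1 = 0) : q ≠ 0 := by rintro rfl; norm_num at hq

/-- **The loop identity** `[x ≠ y] (d(x) c(x,y) + c(y,x)) = c(x,y)` (loop weight `-(q+q⁻¹) = 1`). [folklore] -/
theorem loop_identity (hq : q ^ 2 + q + 1 = 0) (x y : Bool) :
    (if x = y then (0 : ℂ) else tlDiag q x * cW q x y + cW q y x) = cW q x y := by
  have hinv : q⁻¹ = -q - 1 := inv_eq_of_quad hq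
  cases x <;> cases y
  all_goals simp [tlDiag, cW, hinv]
  all_goals linear_combination hq

/-- **The join identity** (no `q³ = 1` needed). [folklore] -/
theorem join_identity (hq0 : q ≠ 0) (x y u v : Bool) (f₁ f₂ : Prop) [Decidable f₁] [Decidable f₂] (hn : ¬(f₁ ∧ f₂)) :
    (if x = y then (0 : ℂ) else tlDiag q x * (Wt q x u f₁ * Wt q v y f₂) + Wt q y u f₁ * Wt q v x f₂) =
      cW q x y * Wt q v u (Xor f₁ f₂) := by
  by_cases h1 : f₁ <;> by_cases h2 : f₂
  · exact absurd ⟨h1, h2⟩ hn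
  all_goals cases x <;> cases y <;> cases u <;> cases v
  all_goals simp [tlDiag, cW, Wt, Xor, h1, h2, inv_mul_cancel₀ hq0, inv_mul_cancel_left₀ hq0]

/-- **The isolate identity** (no `q³ = 1` needed). [folklore] -/
theorem isolate_identity (hq0 : q ≠ 0) (x y u v : Bool) (g₁ g₂ g₃ : Prop) [Decidable g₁] [Decidable g₂] [Decidable g₃] (hor : g₁ ∨ g₂)
    (hiff : g₃ ↔ g₁ ∧ g₂) :
    (if x = y then (0 : ℂ) else tlDiag q x * (Wt q y u g₁ * Wt q v x g₂) + Wt q x u g₁ * Wt q v y g₂) =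
      cW q x y * Wt q v u g₃ := by
  by_cases h1 : g₁ <;> by_cases h2 : g₂
  · have h3 : g₃ := hiff.2 ⟨h1, h2⟩
    cases x <;> cases y <;> cases u <;> cases v
    all_goals simp [tlDiag, cW, Wt, h1, h2, h3, inv_mul_cancel_left₀ hq0]
  · have h3 : ¬g₃ := fun h => h2 (hiff.1 h).2
    cases x <;> cases y <;> cases u <;> cases v
    all_goals simp [tlDiag, cW, Wt, h1, h2, h3, inv_mul_cancel₀ hq0]
  · have h3 : ¬g₃ := fun h => h1 (hiff.1 h).1
    cases x <;> cases y <;> cases u <;> cases v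
    all_goals simp [tlDiag, cW, Wt, h1, h2, h3, inv_mul_cancel₀ hq0]
  · exact absurd hor (by tauto)

end Identities

/-! ### Equivariance under the join -/

section JoinEq

variable {q : ℂ} (hq : q ^ 2 + q + 1 = 0) (b : Fin m) (σ : SpinConfig (2 * m + 1)) (s : NCState (m + 1))

/-- The successor of `b` is `b+1` when they are related. [folklore] -/
theorem nxt_eq_succ_of_rel (h : s.1 (Fin.castSucc b) b.succ = true) : nxt s (Fin.castSucc b) = b.succ := by
  refine nxt_unique s h fun k hk _ => ?_
  exfalso
  unfold cyc at hk; rw [if_pos (Fin.castSucc_lt_succ (i := b))] at hk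
  have h1 := Fin.lt_def.1 hk.1; have h2 := Fin.lt_def.1 hk.2
  simp at h1 h2; omega

/-- The join of related sites is the identity on the successor. [folklore] -/
theorem nxt_joinS_of_rel (h : s.1 (Fin.castSucc b) b.succ = true) : nxt (NCState.joinS (Fin.castSucc b) b.succ (by simp) s) = nxt s := by
  have : NCState.joinS (Fin.castSucc b) b.succ (by simp) s = s := by
    apply Subtype.ext
    funext i j
    simp only [NCState.joinS_val]
    apply Bool.eq_iff_iff.2
    rw [SiteRel.join_eq_true_iff]
    constructor
    · rintro (h' | ⟨h1, h2⟩ | ⟨h1, h2⟩)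
      · exact h'
      · exact s.2.trans _ _ _ h1 (s.2.trans _ _ _ h h2)
      · exact s.2.trans _ _ _ h1 (s.2.trans _ _ _ (s.2.symm _ _ h) h2)
    · exact fun h' => Or.inl h'
  rw [this]

/-- The spins at the two join positions. [folklore] -/
theorem sh_join_left : sh σ (2 * (Fin.castSucc b : Fin (m + 1)).val + 1) = σ (jL b) := by
  rw [show 2 * (Fin.castSucc b : Fin (m + 1)).val + 1 = (jL b).val + 1 by simp [jL], sh_site]

/-- The spins at the two join positions. [folklore] -/
theorem sh_join_right : sh σ (2 * (b.succ : Fin (m + 1)).val) = σ (jR b) := by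
  rw [show 2 * (b.succ : Fin (m + 1)).val = (jR b).val + 1 by simp [jR]; ring, sh_site]

include hq

/-- **Equivariance of the embedding under the join `e_{2b+1}`**:
`Mc(σ, join s) = [σ_{2b} ≠ σ_{2b+1}] (d(σ_{2b}) Mc(σ, s) + Mc(σ^{(2b, 2b+1)}, s))`. [cite: IkhlefPonsaing2012, §3.1] -/
theorem embMc_joinS :
    embMc q σ (NCState.joinS (Fin.castSucc b) b.succ (by simp) s) =
      if σ (jL b) = σ (jR b) then 0 else tlDiag q (σ (jL b)) * embMc q σ s + embMc q (spinFlip (jL b) (jR b) σ) s := by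
  classical
  set cb : Fin (m + 1) := Fin.castSucc b with hcb
  set sb : Fin (m + 1) := b.succ with hsb
  have hne := jL_ne_jR b
  by_cases hrel : s.1 cb sb = true
  · -- the two sites are already connected: loop
    have hn : nxt s cb = sb := nxt_eq_succ_of_rel b s hrel
    have hrest : ∀ τ : SpinConfig (2 * m + 1), embMc q τ s = arcW q τ cb sb * ∏ p ∈ univ.erase cb, arcW q τ p (nxt s p) := fun τ => by
      unfold embMc; rw [← mul_prod_erase univ _ (mem_univ cb), hn]
    have hfix : ∏ p ∈ univ.erase cb, arcW q (spinFlip (jL b) (jR b) σ) p (nxt s p) = ∏ p ∈ univ.erase cb, arcW q σ p (nxt s p) := by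
      refine prod_congr rfl fun p hp => arcW_spinFlip_of_ne q hne σ ?_ ?_ ?_ ?_
      · have := ne_of_mem_erase hp; intro h; apply this; exact Fin.ext (by simp [jL] at h; simp [hcb]; omega)
      · simp [jR]; omega
      · simp [jL]; omega
      · intro h
        have : nxt s p = sb := Fin.ext (by simp [jR] at h; simp [hsb]; omega)
        rw [← hn] at this
        exact ne_of_mem_erase hp (nxt_injective s this)
    rw [show embMc q σ (NCState.joinS (Fin.castSucc b) b.succ (by simp) s) = embMc q σ s by unfold embMc; rw [nxt_joinS_of_rel b s hrel],
      hrest σ, hrest (spinFlip (jL b) (jR b) σ), hfix]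
    have hW : ∀ τ : SpinConfig (2 * m + 1), arcW q τ cb sb = cW q (τ (jL b)) (τ (jR b)) := fun τ => by
      unfold arcW Wt; rw [if_pos (Fin.castSucc_lt_succ (i := b)), sh_join_left, sh_join_right]
    rw [hW, hW, spinFlip_apply_left hne, spinFlip_apply_right]
    have := loop_identity hq (σ (jL b)) (σ (jR b))
    split_ifs with h
    · rw [if_pos h] at this; rw [← this, zero_mul]
    · rw [if_neg h] at this
      linear_combination (-(∏ p ∈ univ.erase cb, arcW q σ p (nxt s p))) * this
  · -- the genuine join
    set t := prd s sb with ht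
    set nb := nxt s cb with hnb
    have hct : cb ≠ t := fun h => hrel (by rw [h, ht]; exact s.2.symm _ _ (rel_prd s sb))
    have hnt : nxt s t = sb := by rw [ht, nxt_prd]
    have hrule := nxt_joinS s b hrel
    -- the three products
    have hnew : embMc q σ (NCState.joinS cb sb (by rw [hcb, hsb]; simp) s) =
        arcW q σ cb sb * arcW q σ t nb * ∏ p ∈ (univ.erase cb).erase t, arcW q σ p (nxt s p) := by
      unfold embMc; rw [hrule]
      change ∏ p, arcW q σ p (nxt s (Equiv.swap cb t p)) = _
      rw [prod_nxt_swap hct (nxt s) (arcW q σ), hnt]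
    have hold : ∀ τ : SpinConfig (2 * m + 1), embMc q τ s = arcW q τ cb nb * arcW q τ t sb * ∏ p ∈ (univ.erase cb).erase t, arcW q τ p (nxt s p) :=
      fun τ => by unfold embMc; rw [prod_split_two hct, hnt]
    have hfix : ∏ p ∈ (univ.erase cb).erase t, arcW q (spinFlip (jL b) (jR b) σ) p (nxt s p) =
        ∏ p ∈ (univ.erase cb).erase t, arcW q σ p (nxt s p) := by
      refine prod_congr rfl fun p hp => arcW_spinFlip_of_ne q hne σ ?_ ?_ ?_ ?_
      · have := ne_of_mem_erase (mem_of_mem_erase hp); intro h; apply this; exact Fin.ext (by simp [jL] at h; simp [hcb]; omega)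
      · simp [jR]; omega
      · simp [jL]; omega
      · intro h
        have : nxt s p = sb := Fin.ext (by simp [jR] at h; simp [hsb]; omega)
        rw [← hnt] at this
        exact ne_of_mem_erase hp (nxt_injective s this)
    rw [hnew, hold σ, hold (spinFlip (jL b) (jR b) σ), hfix]
    -- the four spins
    set x := σ (jL b) with hx
    set y := σ (jR b) with hy
    set u := sh σ (2 * nb.val) with hu
    set v := sh σ (2 * t.val + 1) with hv
    have hpos1 : 2 * t.val + 1 ≠ (jL b).val + 1 := by
      intro h; apply hct; exact Fin.ext (by simp [jL] at h; simp [hcb]; omega)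
    have hpos2 : 2 * t.val + 1 ≠ (jR b).val + 1 := by simp [jR]; omega
    have hpos3 : 2 * nb.val ≠ (jL b).val + 1 := by simp [jL]; omega
    have hpos4 : 2 * nb.val ≠ (jR b).val + 1 := by
      intro h
      have : nb = sb := Fin.ext (by simp [jR] at h; simp [hsb]; omega)
      exact hrel (by rw [← this, hnb]; exact rel_nxt s cb)
    have e1 : arcW q σ cb sb = Wt q x y True := by
      unfold arcW; rw [sh_join_left, sh_join_right]; unfold Wt; rw [if_pos (Fin.castSucc_lt_succ (i := b)), if_pos trivial]
    have e2 : arcW q σ t nb = Wt q v u (t < nb) := rfl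
    have e3 : arcW q σ cb nb = Wt q x u (cb < nb) := by unfold arcW; rw [sh_join_left]
    have e4 : arcW q σ t sb = Wt q v y (t < sb) := by unfold arcW; rw [sh_join_right]
    have e5 : arcW q (spinFlip (jL b) (jR b) σ) cb nb = Wt q y u (cb < nb) := by
      unfold arcW; rw [sh_join_left, spinFlip_apply_left hne, sh_spinFlip hne, if_neg hpos3, if_neg hpos4]
    have e6 : arcW q (spinFlip (jL b) (jR b) σ) t sb = Wt q v x (t < sb) := by
      unfold arcW; rw [sh_join_right, spinFlip_apply_right, sh_spinFlip hne, if_neg hpos1, if_neg hpos2]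
    rw [e1, e2, e3, e4, e5, e6]
    obtain ⟨g1, g2⟩ := join_geometry s b hrel
    have key := join_identity (ne_zero_of_quad' hq) x y u v (cb < nb) (t < sb) g1
    have hW : Wt q v u (t < nb) = Wt q v u (Xor (cb < nb) (t < sb)) := by
      unfold Wt; rw [if_congr g2 rfl rfl]
    rw [hW]
    generalize ∏ p ∈ (univ.erase cb).erase t, arcW q σ p (nxt s p) = R
    split_ifs with h
    · rw [if_pos h] at key
      have : cW q x y = 0 := by unfold cW; rw [if_pos h]
      rw [show Wt q x y True = cW q x y by unfold Wt; rw [if_pos trivial], this]; ring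
    · rw [if_neg h] at key
      rw [show Wt q x y True = cW q x y by unfold Wt; rw [if_pos trivial]]
      linear_combination R * key.symm

end JoinEq

/-! ### Equivariance under the isolation -/

section IsolEq

variable {q : ℂ} (hq : q ^ 2 + q + 1 = 0) (b : Fin m) (σ : SpinConfig (2 * m + 1)) (s : NCState (m + 1))

/-- The spins at the two isolation positions. [folklore] -/
theorem sh_isol_left : sh σ (2 * (b.succ : Fin (m + 1)).val) = σ (iL b) := by
  rw [show 2 * (b.succ : Fin (m + 1)).val = (iL b).val + 1 by simp [iL]; ring, sh_site]

/-- The spins at the two isolation positions. [folklore] -/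
theorem sh_isol_right : sh σ (2 * (b.succ : Fin (m + 1)).val + 1) = σ (iR b) := by
  rw [show 2 * (b.succ : Fin (m + 1)).val + 1 = (iR b).val + 1 by simp [iR]; ring, sh_site]

include hq

/-- **Equivariance of the embedding under the isolation `e_{2b+2}`**:
`Mc(σ, isolate s) = [σ_{2b+1} ≠ σ_{2b+2}] (d(σ_{2b+1}) Mc(σ, s) + Mc(σ^{(2b+1, 2b+2)}, s))`. [cite: IkhlefPonsaing2012, §3.1] -/
theorem embMc_isolS :
    embMc q σ (NCState.isolS b.succ s) =
      if σ (iL b) = σ (iR b) then 0 else tlDiag q (σ (iL b)) * embMc q σ s + embMc q (spinFlip (iL b) (iR b) σ) s := by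
  classical
  set sb : Fin (m + 1) := b.succ with hsb
  have hne := iL_ne_iR b
  have hrule := nxt_isolS s sb
  by_cases hsing : nxt s sb = sb
  · -- a singleton: loop
    have hpr : prd s sb = sb := by have := prd_nxt s sb; rw [hsing] at this; exact this
    have hrule' : nxt (NCState.isolS sb s) = nxt s := by rw [hrule, hpr, Equiv.swap_self]; rfl
    have hrest : ∀ τ : SpinConfig (2 * m + 1), embMc q τ s = arcW q τ sb sb * ∏ p ∈ univ.erase sb, arcW q τ p (nxt s p) := fun τ => by
      unfold embMc; rw [← mul_prod_erase univ _ (mem_univ sb), hsing]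
    have hfix : ∏ p ∈ univ.erase sb, arcW q (spinFlip (iL b) (iR b) σ) p (nxt s p) = ∏ p ∈ univ.erase sb, arcW q σ p (nxt s p) := by
      refine prod_congr rfl fun p hp => arcW_spinFlip_of_ne q hne σ ?_ ?_ ?_ ?_
      · simp [iL]; omega
      · have := ne_of_mem_erase hp; intro h; apply this; exact Fin.ext (by simp [iR] at h; simp [hsb]; omega)
      · intro h
        have : nxt s p = sb := Fin.ext (by simp [iL] at h; simp [hsb]; omega)
        rw [← hsing] at this
        exact ne_of_mem_erase hp (nxt_injective s this)
      · simp [iR]; omega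
    rw [show embMc q σ (NCState.isolS sb s) = embMc q σ s by unfold embMc; rw [hrule'], hrest σ, hrest (spinFlip (iL b) (iR b) σ), hfix]
    have hW : ∀ τ : SpinConfig (2 * m + 1), arcW q τ sb sb = cW q (τ (iL b)) (τ (iR b)) := fun τ => by
      unfold arcW Wt; rw [if_neg (lt_irrefl _), sh_isol_left, sh_isol_right]
    rw [hW, hW, spinFlip_apply_left hne, spinFlip_apply_right]
    have := loop_identity hq (σ (iL b)) (σ (iR b))
    split_ifs with h
    · rw [if_pos h] at this; rw [← this, zero_mul]
    · rw [if_neg h] at this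
      linear_combination (-(∏ p ∈ univ.erase sb, arcW q σ p (nxt s p))) * this
  · -- the genuine isolation
    set pb := prd s sb with hpb
    set nb := nxt s sb with hnb
    have hct : sb ≠ pb := fun h => hsing (by rw [hnb]; have := nxt_prd s sb; rw [← hpb, ← h] at this; exact this)
    have hnt : nxt s pb = sb := by rw [hpb, nxt_prd]
    have hnew : embMc q σ (NCState.isolS sb s) = arcW q σ sb sb * arcW q σ pb nb * ∏ p ∈ (univ.erase sb).erase pb, arcW q σ p (nxt s p) := by
      unfold embMc; rw [hrule]
      change ∏ p, arcW q σ p (nxt s (Equiv.swap sb pb p)) = _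
      rw [prod_nxt_swap hct (nxt s) (arcW q σ), hnt]
    have hold : ∀ τ : SpinConfig (2 * m + 1), embMc q τ s = arcW q τ sb nb * arcW q τ pb sb * ∏ p ∈ (univ.erase sb).erase pb, arcW q τ p (nxt s p) :=
      fun τ => by unfold embMc; rw [prod_split_two hct, hnt]
    have hfix : ∏ p ∈ (univ.erase sb).erase pb, arcW q (spinFlip (iL b) (iR b) σ) p (nxt s p) =
        ∏ p ∈ (univ.erase sb).erase pb, arcW q σ p (nxt s p) := by
      refine prod_congr rfl fun p hp => arcW_spinFlip_of_ne q hne σ ?_ ?_ ?_ ?_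
      · simp [iL]; omega
      · have := ne_of_mem_erase (mem_of_mem_erase hp); intro h; apply this; exact Fin.ext (by simp [iR] at h; simp [hsb]; omega)
      · intro h
        have : nxt s p = sb := Fin.ext (by simp [iL] at h; simp [hsb]; omega)
        rw [← hnt] at this
        exact ne_of_mem_erase hp (nxt_injective s this)
      · simp [iR]; omega
    rw [hnew, hold σ, hold (spinFlip (iL b) (iR b) σ), hfix]
    set x := σ (iL b) with hx
    set y := σ (iR b) with hy
    set u := sh σ (2 * nb.val) with hu
    set v := sh σ (2 * pb.val + 1) with hv
    have hpos1 : 2 * pb.val + 1 ≠ (iL b).val + 1 := by simp [iL]; omega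
    have hpos2 : 2 * pb.val + 1 ≠ (iR b).val + 1 := by
      intro h; apply hct; exact Fin.ext (by simp [iR] at h; simp [hsb]; omega)
    have hpos3 : 2 * nb.val ≠ (iL b).val + 1 := by
      intro h; apply hsing; exact Fin.ext (by simp [iL] at h; simp [hsb, hnb] at h ⊢; omega)
    have hpos4 : 2 * nb.val ≠ (iR b).val + 1 := by simp [iR]; omega
    have e1 : arcW q σ sb sb = cW q x y := by
      unfold arcW Wt; rw [if_neg (lt_irrefl _), sh_isol_left, sh_isol_right]
    have e2 : arcW q σ pb nb = Wt q v u (pb < nb) := rfl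
    have e3 : arcW q σ sb nb = Wt q y u (sb < nb) := by unfold arcW; rw [sh_isol_right]
    have e4 : arcW q σ pb sb = Wt q v x (pb < sb) := by unfold arcW; rw [sh_isol_left]
    have e5 : arcW q (spinFlip (iL b) (iR b) σ) sb nb = Wt q x u (sb < nb) := by
      unfold arcW; rw [sh_isol_right, spinFlip_apply_right, sh_spinFlip hne, if_neg hpos3, if_neg hpos4]
    have e6 : arcW q (spinFlip (iL b) (iR b) σ) pb sb = Wt q v y (pb < sb) := by
      unfold arcW; rw [sh_isol_left, spinFlip_apply_left hne, sh_spinFlip hne, if_neg hpos1, if_neg hpos2]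
    rw [e1, e2, e3, e4, e5, e6]
    obtain ⟨g1, g2⟩ := isolate_geometry s sb hsing
    have key := isolate_identity (ne_zero_of_quad' hq) x y u v (sb < nb) (pb < sb) (pb < nb) g1 g2
    generalize ∏ p ∈ (univ.erase sb).erase pb, arcW q σ p (nxt s p) = R
    split_ifs with h
    · rw [if_pos h] at key
      have : cW q x y = 0 := by unfold cW; rw [if_pos h]
      rw [this]; ring
    · rw [if_neg h] at key
      linear_combination R * key.symm

end IsolEq

end Literature.Probability.Percolation
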